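import Summits.BirchSwinnertonDyer.BirchSwinnertonDyer.Theses.SignedLowerHalves
import Summits.BirchSwinnertonDyer.BirchSwinnertonDyer.Theorems.SignedLowerHalvesKobayashiLowerHalfLargeImagePairedDescent
import Literature.NumberTheory.EllipticCurves.SemistabilityDefect
import HarnessLib

/-!
# Line `cyclic-semistabilisation` — crux `KobayashiLowerHalfLargeImage` (route SignedLowerHalves, item
# stmt-BirchSwinnertonDyer-19001): SEMISTABILISING ABELIAN BASE CHANGE + CHARACTER SANDWICH

HONEST FRAMING (D-0152): this line feeds the CLASS route K3 = `SignedLowerHalves`, whose `closes` reaches the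
rung-K3 leaf `SignedSupersingular` only; nothing here proves BSD; every `stub_*` is `sorry`; the composition
only shows that the stubs, if proved, give the crux BY NAME. Seat: planner-cruxidea-stmt-BirchSwinnertonDyer-
19001-2-g13 (crux-ideate round 1, k = 2). W-79: this file is published with `ledger crux write` only; the
crux's skeleton slot (line of record `Lines/kurihara_rigidity.lean`, lead bsd-line-slh-p1) is NOT touched.

## The lever (one sentence)
Kill the additive primes instead of confronting them: over a totally real ABELIAN field `F/ℚ` ramified exactly
enough at each additive prime `q` of `E` (degree a `{2,3}`-number, so prime to `p ≥ 5`; `p` totally split;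
`[F:ℚ]` even), the base change `E_F` is SEMISTABLE — its Hilbert newform has SQUARE-FREE level, every local
type is unramified-or-Steinberg, and the even degree opens the definite-quaternion (parity) door — so the
Eisenstein half of the signed main conjecture is to be proved THERE, in the square-free-level regime where the
`ℚ`-arguments (BSTW / CLW / CÇSS) are charted, and DESCENDED to `ℚ` through the character decomposition
`X^ε(E/F_∞) ⊗ 𝒪 ≅ ⊕_χ X^ε(f ⊗ χ)`, `L^ε_p(E/F) ≐ ∏_χ L^ε_p(f ⊗ χ)` (`p ∤ [F:ℚ]`, `p` totally split) with
Kato's integral UPPER bound at every twist as the other slice of bread (a product divisibility plus per-factor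
upper bounds in the domain `Λ` forces the factor `χ = 1`, which is the crux at the pair).

Such an `F` exists iff NO additive prime of `E` is of supercuspidal type (local class field theory: the
semistability defect `e_q = |Φ_q|` must divide `q - 1` for `q ≥ 5`, or equal `2`): the ABELIAN STRATUM.
Its QUADRATIC SUB-STRATUM (every additive prime odd with defect `e_q = 2`: potentially multiplicative, or
potentially good of Kodaira type `I₀*`) is semistabilised by ONE real quadratic field `F = ℚ(√d_F)`, `d_F`
divisible by every additive prime, `d_F ≡ 1 (4)`, `(d_F/p) = 1`; there the descent is the tree's PAIRED
currency `PairedKobayashiLowerDivisibility W W^{(d_F)} p ε` and the landed door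
`X7.kobayashiLowerDivisibility_of_paired_twist`, so the whole quadratic stratum is typed below over existing
declarations. The CYCLIC sub-stratum (some additive `q ≥ 5` with `e_q ∈ {3,4,6}`, `e_q ∣ q - 1`: ramified
principal series) needs cyclic cubic/quartic/sextic pieces of `F` and, for a typed descent, signed `p`-adic
`L`-functions of the newforms `f ⊗ χ` with nebentypus (not in the tree): it is carried here as ONE stub over
the typed field predicate `IsAbelianSemistabilisingField` (conclusion = the crux's, engine informal; see the
line card). Pairs with a supercuspidal prime are the population of the line `cartan-chamber`; `p = 3` is the
shared residue.

CENSUS (cell bsd-ssimc, `x7census.tsv` × `fw_x7.tsv`, large-image X7 pairs): at `p ≥ 5`, 3764 pairs =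
1338 tame-abelianisable (1141 quadratic-only, 197 needing a cyclic piece of order 3, 4 or 6) + 327 with a
tame supercuspidal prime + 2099 with a wild prime `2, 3` (type undecided by the census); OFF the Fouquet–Wan
locus at `p ≥ 5`: 244 = 61 abelianisable (46 quadratic, 15 cyclic: e.g. 87906bl1 @5 [7:PS3], 493311k1 @5
[13:PS4], 262626by1 @5 [13:PS6]) + 29 supercuspidal + 154 wild-undecided.

## Stubs (6) and composition
`stub_semistabilisingDiscriminant` (S+M, closable from print: CRT/Dirichlet + Néron–Serre–Tate: a curve of
defect `2` at odd `q` becomes semistable over ANY ramified quadratic extension of `ℚ_q`) ·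
`stub_semistableHilbertEisenstein` (XL, OPEN — THE ENGINE: Eisenstein half of the signed main conjecture for
the SEMISTABLE base change `E_F`, `F` real quadratic, `p` split, output in paired product form) ·
`stub_pairedDoor` (S: the landed door + the named published facts it consumes) · `stub_cyclicStratum` (OPEN,
engine + cyclic descent informal; typed over `IsAbelianSemistabilisingField`) · `stub_offStratum` (residue:
no abelian semistabilising field — supercuspidal / wild; NOT attacked) · `stub_three` (`p = 3`).
Composition `lowerHalf_of_stubs` by cases (quadratic stratum → discriminant → engine → door; else abelian
field → cyclic stub; else residue; `p = 3`), and `KobayashiLowerHalfLargeImage_of : <the crux>`.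
-/

set_option autoImplicit false
set_option linter.dupNamespace false

noncomputable section

open scoped Classical MatrixGroups ModularForm NumberField

open CongruenceSubgroup WeierstrassCurve Literature.NumberTheory.EllipticCurves
  Literature.NumberTheory.EllipticCurves.ModularForms
  Literature.NumberTheory.EllipticCurves.Rank1Residual
  Literature.NumberTheory.EllipticCurves.Rank1Residual.Typed
  Literature.NumberTheory.EllipticCurves.Kobayashi2003 ZpExtension
  Summit.BirchSwinnertonDyer.Rank1Residual.Supersingular
  Summit.BirchSwinnertonDyer.BirchSwinnertonDyer.Theorems
  IsDedekindDomain NumberField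

namespace Summit.BirchSwinnertonDyer.BirchSwinnertonDyer.Cruxes.KobayashiLowerHalfLargeImage

namespace CyclicSemistabilisation

/-! ### Typed vocabulary of the line (predicates with bodies; nothing asserted) -/

/-- `q` is an ADDITIVE prime of the globally minimal `W/ℚ` (neither good nor multiplicative reduction). -/
def IsAdditivePrime (W : WeierstrassCurve ℚ) [W.IsElliptic] [W.IsGloballyMinimal] (q : ℕ)
    [Fact q.Prime] : Prop :=
  ¬ W.HasGoodReductionAtPrime q ∧ ¬ W.HasMultiplicativeReductionAtPrime q

/-- The QUADRATIC STRATUM: every additive prime `q` of `W` is odd and has Kraus semistability defect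
`e_q = 2` (tree `WeierstrassCurve.semistabilityDefectAt`): potentially multiplicative reduction, or potentially
good reduction acquired over a ramified quadratic extension (type `I₀*` at `q ≥ 5`, `v_q(Δ) = 6`).
[cite: Kraus1990, §1 (défaut de semi-stabilité)] [cite: Serre1972, §5.6 (`Φ_q` cyclic of order
`12/gcd(12, v_q Δ)` at `q ≥ 5`)] -/
def IsQuadraticStratum (W : WeierstrassCurve ℚ) [W.IsElliptic] [W.IsGloballyMinimal] : Prop :=
  ∀ (q : ℕ) [Fact q.Prime], IsAdditivePrime W q → q ≠ 2 ∧ W.semistabilityDefectAt q = 2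

/-- `d_F` is a SEMISTABILISING DISCRIMINANT for `(W, p)`: `d_F > 0` squarefree, `d_F ≡ 1 (mod 4)` (so `2`
is unramified in `F = ℚ(√d_F)` and `F` is real), `p ∤ d_F` and `d_F` a square mod `p` (so the odd prime `p`
SPLITS in `F` — required for Kobayashi's `±` local conditions over `F_w = ℚ_p`), and EVERY additive prime of
`W` divides `d_F` (ramifies in `F`). Primes of good or multiplicative reduction may divide `d_F` freely: good
and multiplicative reduction persist under base change. -/
def IsSemistabilisingDiscriminant (W : WeierstrassCurve ℚ) [W.IsElliptic] [W.IsGloballyMinimal]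
    (p : ℕ) (dF : ℤ) : Prop :=
  0 < dF ∧ Squarefree dF ∧ dF % 4 = 1 ∧ ¬ (p : ℤ) ∣ dF ∧ IsSquare ((dF : ℤ) : ZMod p) ∧
    ∀ (q : ℕ) [Fact q.Prime], IsAdditivePrime W q → (q : ℤ) ∣ dF

/-- The number field `F` "is" `ℚ(√d_F)`: degree `2` and `d_F` is a square in `F`. -/
def IsQuadraticFieldOfDisc (F : Type) [Field F] [NumberField F] (dF : ℤ) : Prop :=
  Module.finrank ℚ F = 2 ∧ ∃ x : F, x ^ 2 = (dF : F)

/-- `F` is an ABELIAN SEMISTABILISING FIELD for `(W, p)` (the object of the whole lever, all strata):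
`F/ℚ` Galois with commuting automorphisms (abelian), totally real, of EVEN degree PRIME TO `p`, with `p`
TOTALLY SPLIT (`e = f = 1` at every prime above `p`: the `±` local conditions live over `F_w = ℚ_p`, and
`Γ_F ↠ Gal(F_∞/F) ≅ Gal(ℚ_∞/ℚ)`), over which the base change of `W` is SEMISTABLE at every finite place
(tree `WeierstrassCurve.IsSemistable`). By local class field theory such an `F` exists iff every additive
prime `q` of `W` has defect `e_q = 2` or (`q ≥ 5` and `e_q ∣ q - 1`) [principal-series or potentially
multiplicative type; no supercuspidal prime]; it can be taken inside a cyclotomic field, of degree dividing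
`2 · 12`. Nothing asserted. [cite: SerreTate1968, §2 Cor. 2 (semistable reduction over `K'` iff
`I(K') ` acts unipotently; tame case `e_q ∣ e(K'/ℚ_q)`)] [cite: Washington1997, Ch. 3 (subfields of
cyclotomic fields and their ramification)] -/
def IsAbelianSemistabilisingField (W : WeierstrassCurve ℚ) [W.IsElliptic] [W.IsGloballyMinimal] (p : ℕ)
    (F : Type) [Field F] [NumberField F] : Prop :=
  IsGalois ℚ F ∧ (∀ σ τ : F ≃ₐ[ℚ] F, σ * τ = τ * σ) ∧ IsTotallyReal F ∧
    Even (Module.finrank ℚ F) ∧ ¬ (p ∣ Module.finrank ℚ F) ∧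
    (∀ w : HeightOneSpectrum (𝓞 F), (p : 𝓞 F) ∈ w.asIdeal →
      w.asIdeal.ramificationIdx ℤ = 1 ∧ w.asIdeal.inertiaDeg ℤ = 1) ∧
    WeierstrassCurve.IsSemistable (𝓞 F) (W.baseChange F)

/-- For the record (the cyclic stratum's ALGEBRAIC side is typed): the signed Selmer dual of the base change
over the cyclotomic `ℤ_p`-extension of `F` is the tree's `SignedSelmerDualData` over the number field `F`
(Kobayashi's `±` conditions at every place `w ∣ p`, all of degree one here); its characteristic ideal lives in
the same `Λ = ℤ_p⟦T⟧`. What is NOT typed in the tree is the ANALYTIC side over `F` (signed `p`-adic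
`L`-functions of `f ⊗ χ` for `χ` of order `3, 4, 6`, i.e. newforms with nebentypus). -/
def fSideCharIdeal {W : WeierstrassCurve ℚ} {p : ℕ} [Fact p.Prime] {F : Type} [Field F] [NumberField F]
    {κF : ZpExtension F p} {γF : Field.absoluteGaloisGroup F} {ε : ℤˣ}
    (DF : SignedSelmerDualData (W.baseChange F) κF γF ε) : Ideal (IwasawaAlgebra p) :=
  DF.charIdeal

/-! ### Stub statements -/

/-- Statement of `stub_semistabilisingDiscriminant` (closable from print): on the quadratic stratum at a good
prime `p ≥ 5` there is a semistabilising discriminant `d_F`, and over `F = ℚ(√d_F)` the curve is semistable.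
(Existence: `d_F = d₀ ℓ` with `d₀` the product of the additive primes and `ℓ` an auxiliary prime in the residue
classes making `d_F ≡ 1 (4)` and `(d_F/p) = 1` — Dirichlet. Semistability: at an additive `q` (odd, defect
`2`) the curve is a ramified quadratic twist of a semistable curve over `ℚ_q^{nr}`, which has a UNIQUE
ramified quadratic extension, so ANY ramified quadratic `F_w/ℚ_q` works; elsewhere good/multiplicative
reduction persists.) -/
def SemistabilisingDiscriminantStatement : Prop :=
  ∀ (W : WeierstrassCurve ℚ) [W.IsElliptic] [W.IsGloballyMinimal] (p : ℕ) [Fact p.Prime],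
    5 ≤ p → W.HasGoodReductionAtPrime p → IsQuadraticStratum W →
    ∃ dF : ℤ, IsSemistabilisingDiscriminant W p dF ∧
      ∀ (F : Type) [Field F] [NumberField F], IsQuadraticFieldOfDisc F dF →
        WeierstrassCurve.IsSemistable (𝓞 F) (W.baseChange F)

/-- Statement of THE ENGINE `stub_semistableHilbertEisenstein` (OPEN, XL), in the route's own currency: for an
X7 pair `(W, p)`, `p ≥ 5`, `a_p = 0`, no CM, `ρ̄` onto, a semistabilising discriminant `d_F` OVER WHOSE FIELD
THE CURVE IS SEMISTABLE, and any globally minimal model `W'` of `W^{(d_F)}`, the PAIRED signed lower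
divisibility `ϖϖ'·L^ε_p(E)·L^ε_p(E^{(d_F)}) ∣ char X^ε(E)·char X^ε(E^{(d_F)})` holds for every sign `ε` — the
product form (`X^ε(E/F_∞) ≅ X^ε(E/ℚ_∞) ⊕ X^ε(E^{(d_F)}/ℚ_∞)`, Artin formalism) of the Eisenstein half of the
signed main conjecture for the SEMISTABLE Hilbert newform `BC_{F/ℚ}(f)` of square-free level over the real
quadratic `F`, `p` split. Transfer target `C⁺`; see the line card for the two candidate architectures
(U(3,1)/F Eisenstein family à la Wan–BSTW; bipartite Heegner/BDP à la CÇSS over `F`). -/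
def SemistableHilbertEisensteinStatement : Prop :=
  ∀ (W : WeierstrassCurve ℚ) [W.IsElliptic] [W.IsGloballyMinimal] (p : ℕ) [Fact p.Prime],
    5 ≤ p → ClassX7 W p → ¬ W.HasCM → W.frobeniusTrace p = 0 → Surj W p →
    ∀ (dF : ℤ), IsSemistabilisingDiscriminant W p dF →
    (∀ (F : Type) [Field F] [NumberField F], IsQuadraticFieldOfDisc F dF →
        WeierstrassCurve.IsSemistable (𝓞 F) (W.baseChange F)) →
    ∀ (W' : WeierstrassCurve ℚ) [W'.IsElliptic] [W'.IsGloballyMinimal] (C : VariableChange ℚ),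
      C • W' = W.quadraticTwist (dF : ℚ) →
    ∀ ε : ℤˣ, PairedKobayashiLowerDivisibility W W' p ε

/-- Statement of `stub_pairedDoor` (published inputs only, size S): for a semistabilising discriminant
(`d_F` squarefree, `p ∤ 2 d_F` since `p ∤ d_F` and `p` is odd) the landed door
`X7.kobayashiLowerDivisibility_of_paired_twist` separates the factor of `W` from the paired lower divisibility,
modulo the NAMED published facts it consumes (Kobayashi 2003 Thm 1.2 / Thm 4.1 at the twist, Pollack's
non-vanishing, the period unit, modularity, Wuthrich 2014 Lemma 20). -/
def PairedDoorStatement : Prop :=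
  ∀ (W : WeierstrassCurve ℚ) [W.IsElliptic] [W.IsGloballyMinimal] (p : ℕ) [Fact p.Prime],
    5 ≤ p → ClassX7 W p → W.frobeniusTrace p = 0 → Surj W p →
    ∀ (dF : ℤ), IsSemistabilisingDiscriminant W p dF →
    ∀ (W' : WeierstrassCurve ℚ) [W'.IsElliptic] [W'.IsGloballyMinimal] (C : VariableChange ℚ),
      C • W' = W.quadraticTwist (dF : ℚ) →
    ∀ ε : ℤˣ, PairedKobayashiLowerDivisibility W W' p ε → KobayashiLowerDivisibility W p ε

/-- Statement of `stub_cyclicStratum` (OPEN; the CYCLIC extension of the lever, engine + descent informal):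
an X7 large-image pair at `p ≥ 5` outside the quadratic stratum but WITH an abelian semistabilising field `F`
(some additive `q ≥ 5` of principal-series type `e_q ∈ {3,4,6}`, `e_q ∣ q - 1`) satisfies the crux's
conclusion. Internal structure (line card): Eisenstein half for the semistable `E_F` (same engine as
`stub_semistableHilbertEisenstein`, `[F:ℚ] ∈ {6, 8, 12, 24, …}` a `{2,3}`-number) + the `Ĝ`-indexed
character sandwich (Shapiro, Artin formalism, Kato–Lei upper bounds for `f ⊗ χ`, `ρ̄(G_F) ⊇ SL₂(𝔽_p)`).
The typed descent awaits signed `p`-adic `L`-functions for newforms with nebentypus (definition request). -/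
def CyclicStratumStatement : Prop :=
  ∀ (W : WeierstrassCurve ℚ) [W.IsElliptic] [W.IsGloballyMinimal] (p : ℕ) [Fact p.Prime],
    5 ≤ p → ClassX7 W p → ¬ W.HasCM → W.frobeniusTrace p = 0 → Surj W p →
    ¬ IsQuadraticStratum W →
    ∀ (F : Type) [Field F] [NumberField F], IsAbelianSemistabilisingField W p F →
    ∃ ε : ℤˣ, KobayashiLowerDivisibility W p ε

/-- Statement of the residue `stub_offStratum` (NOT ATTACKED by this line): X7 large-image pairs at `p ≥ 5`
with NO abelian semistabilising field (a supercuspidal additive prime — line `cartan-chamber` —, or a wild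
prime `2, 3` of non-abelian type). -/
def OffStratumStatement : Prop :=
  ∀ (W : WeierstrassCurve ℚ) [W.IsElliptic] [W.IsGloballyMinimal] (p : ℕ) [Fact p.Prime],
    5 ≤ p → ClassX7 W p → ¬ W.HasCM → W.frobeniusTrace p = 0 → Surj W p →
    ¬ IsQuadraticStratum W →
    (¬ ∃ (F : Type) (_ : Field F) (_ : NumberField F), IsAbelianSemistabilisingField W p F) →
    ∃ ε : ℤˣ, KobayashiLowerDivisibility W p ε

/-- Statement of the residue `stub_three` (`p = 3`; shared with the lines hilbert-door, cartan-chamber,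
crossing-rigidity). -/
def ThreeStatement : Prop :=
  ∀ (W : WeierstrassCurve ℚ) [W.IsElliptic] [W.IsGloballyMinimal] (p : ℕ) [Fact p.Prime],
    p = 3 → ClassX7 W p → ¬ W.HasCM → W.frobeniusTrace p = 0 → Surj W p →
    ∃ ε : ℤˣ, KobayashiLowerDivisibility W p ε

/-! ### Registered stubs (every `sorry` of the file is here) -/

/-- `stub_semistabilisingDiscriminant` (size S+M; kernel-closable from print).
[cite: SerreTate1968, §2 Cor. 2] [cite: SilvermanAEC2009, VII.5 Prop. 5.4 and its proof]
[cite: Kraus1990, §1] [cite: Dirichlet — Mathlib `Nat.setOf_prime_and_eq_mod_infinite`] -/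
theorem stub_semistabilisingDiscriminant : SemistabilisingDiscriminantStatement := by
  sorry

/-- `stub_semistableHilbertEisenstein` — THE ENGINE (OPEN, XL): Eisenstein half of the signed main conjecture
for the semistable base change `E_F`, `F = ℚ(√d_F)` real quadratic, `p ≥ 5` split, `a_p = 0`, large image,
in paired product form. NOT IN PRINT (the printed Hilbert Eisenstein-family main conjecture, Wan FMS 2015, is
nearly ordinary). [cite: Wan2015HilbertMC, Thm. 1.1 (nearly ordinary Hilbert modular forms; FMS 3 e18)]
[cite: CastellaLiuWan2022, Thm. 1.2 (square-free `N`, `ℚ`)] [cite: ParkShahabi2011, Prop. 3.1 and §4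
(plus/minus `p`-adic `L`-functions of Hilbert modular forms, `p` totally split)] -/
theorem stub_semistableHilbertEisenstein : SemistableHilbertEisensteinStatement := by
  sorry

/-- `stub_pairedDoor` (size S): `X7.kobayashiLowerDivisibility_of_paired_twist` with its named published
inputs. [cite: Kobayashi2003, Thm. 1.2 (p. 2), Thm. 4.1 (p. 8)] [cite: Pollack2003, Cor. 5.11] -/
theorem stub_pairedDoor : PairedDoorStatement := by
  sorry

/-- `stub_cyclicStratum` (OPEN): the cyclic extension (engine over an abelian `F` of degree a `{2,3}`-number +
character sandwich). [cite: Kato2004Asterisque, Thm. 12.5 (upper bound for newforms with character)]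
[cite: Lei2011, Thm. 1.1 (signed Coleman maps / Kato divisibility for modular forms with `a_p = 0`)] -/
theorem stub_cyclicStratum : CyclicStratumStatement := by
  sorry

/-- `stub_offStratum` — RESIDUE, not attacked here (supercuspidal primes: line cartan-chamber; wild
non-abelian types at `2, 3`: no line). -/
theorem stub_offStratum : OffStratumStatement := by
  sorry

/-- `stub_three` — RESIDUE `p = 3` (shared). -/
theorem stub_three : ThreeStatement := by
  sorry

/-! ### Composition (no sorry below this line) -/

/-- COMPOSITION, explicit form: an odd prime is `3` or `≥ 5`; at `p ≥ 5`, on the quadratic stratum take the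
semistabilising discriminant, a globally minimal model of the twist (Néron), run the engine for the sign `+1`
and open the door; off the quadratic stratum use the cyclic stub if an abelian semistabilising field exists,
else the residue. -/
theorem lowerHalf_of_stubs (hD : SemistabilisingDiscriminantStatement)
    (hE : SemistableHilbertEisensteinStatement) (hP : PairedDoorStatement) (hC : CyclicStratumStatement)
    (hO : OffStratumStatement) (h3 : ThreeStatement) :
    ∀ (W : WeierstrassCurve ℚ) [W.IsElliptic] [W.IsGloballyMinimal] (p : ℕ) [Fact p.Prime],
      p ≠ 2 → ClassX7 W p → ¬ W.HasCM → W.frobeniusTrace p = 0 → Surj W p →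
      ∃ ε : ℤˣ, KobayashiLowerDivisibility W p ε := by
  intro W _ _ p _ hp2 hX hcm hap hs
  have hpP : p.Prime := Fact.out
  by_cases hp5 : 5 ≤ p
  · by_cases hq : IsQuadraticStratum W
    · obtain ⟨dF, hdF, hss⟩ := hD W p hp5 hX.1.1 hq
      have hd0 : ((dF : ℤ) : ℚ) ≠ 0 := by exact_mod_cast hdF.1.ne'
      obtain ⟨W', hE', hM', C, hCW⟩ := exists_isGloballyMinimal_smul_eq_quadraticTwist W hd0
      have hpair : PairedKobayashiLowerDivisibility W W' p 1 :=
        hE W p hp5 hX hcm hap hs dF hdF hss W' C hCW 1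
      exact ⟨1, hP W p hp5 hX hap hs dF hdF W' C hCW 1 hpair⟩
    · by_cases hF : ∃ (F : Type) (_ : Field F) (_ : NumberField F), IsAbelianSemistabilisingField W p F
      · obtain ⟨F, _, _, hFab⟩ := hF
        exact hC W p hp5 hX hcm hap hs hq F hFab
      · exact hO W p hp5 hX hcm hap hs hq hF
  · have hp3 : p = 3 := by
      have h2 := hpP.two_le
      interval_cases p
      · exact absurd rfl hp2
      · rfl
      · exact absurd hpP (by decide)
    exact h3 W p hp3 hX hcm hap hs

/-- THE SKELETON: the crux BY NAME from exactly the six stubs (no sorry of its own). -/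
theorem KobayashiLowerHalfLargeImage_of :
    Summit.BirchSwinnertonDyer.BirchSwinnertonDyer.Theses.SignedLowerHalves.KobayashiLowerHalfLargeImage :=
  lowerHalf_of_stubs stub_semistabilisingDiscriminant stub_semistableHilbertEisenstein stub_pairedDoor
    stub_cyclicStratum stub_offStratum stub_three

/-! ### Sanity anchors (proved, no sorry) -/

/-- A semistabilising discriminant satisfies the door's side condition `p ∤ 2 d_F` at `p ≥ 5`. -/
theorem not_dvd_two_mul_of_isSemistabilisingDiscriminant {W : WeierstrassCurve ℚ} [W.IsElliptic]
    [W.IsGloballyMinimal] {p : ℕ} (hp : p.Prime) (hp5 : 5 ≤ p) {dF : ℤ}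
    (hd : IsSemistabilisingDiscriminant W p dF) : ¬ (p : ℤ) ∣ 2 * dF := by
  intro h
  have hpI : Prime (p : ℤ) := Int.prime_iff_natAbs_prime.mpr (by simpa using hp)
  rcases hpI.dvd_or_dvd h with h2 | h2
  · have : (p : ℤ) ≤ 2 := Int.le_of_dvd (by norm_num) h2
    omega
  · exact hd.2.2.2.1 h2

/-- The paired currency is never stronger than the two lower halves (tree lemma, restated for the line's
objects): if Kobayashi's lower half holds for `W` and for a model `W'` of its twist, the engine's output holds. -/
theorem paired_of_lowerHalves {W W' : WeierstrassCurve ℚ} [W.IsElliptic] [W.IsGloballyMinimal]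
    [W'.IsElliptic] [W'.IsGloballyMinimal] {p : ℕ} [Fact p.Prime] {ε : ℤˣ}
    (h : KobayashiLowerDivisibility W p ε) (h' : KobayashiLowerDivisibility W' p ε) :
    PairedKobayashiLowerDivisibility W W' p ε :=
  pairedKobayashiLowerDivisibility_of_kobayashiLowerDivisibility h h'

end CyclicSemistabilisation

end Summit.BirchSwinnertonDyer.BirchSwinnertonDyer.Cruxes.KobayashiLowerHalfLargeImage
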